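import Literature.Combinatorics.Digraph.LineDigraphRootedArborescences
import HarnessLib

/-!
# The tree enumerators of the complete digraph and of the complete bipartite digraph:
# `κ^{vertex}(K⃗_n) = (x_1 + ⋯ + x_n)^{n−1}` (Cayley) and
# `κ^{vertex}(K⃗_{m,n}) = (x_1 + ⋯ + x_m + y_1 + ⋯ + y_n)(x_1 + ⋯ + x_m)^{n−1}(y_1 + ⋯ + y_n)^{m−1}`,
# with Levine's Theorems 1.1 and 2.3 over every commutative ring of weights

Topic `Literature/Combinatorics/Digraph`, namespace `Literature.Combinatorics.Digraph.Multidigraph`.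
Lane `lit-hodgefound`, seat p23, generation 46, row g46-#11 of the programme «The spectrum of the arc
digraph and de Bruijn's count `2^{2^{n−1}−n}`» (sequel of `LineDigraphWeightedArborescences` — Theorem
1.1 — and `LineDigraphRootedArborescences` — Theorem 2.3).

## Source, verbatim

L. Levine, *Sandpile groups and spanning trees of directed line graphs*, J. Combin. Theory Ser. A 118
(2011) 350–364 [Levine2011] (held text `paper:arxiv-0906.2809`, chunk p0007):
«**2.2 Complete graph.** Taking `G` to be the graph with one vertex and `n` loops, so that `LG` is the
complete directed graph `K⃗_n` on `n` vertices (including a loop at each vertex), we obtain from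
Theorem 1.1 the classical formula `κ^{vertex}(K⃗_n) = (x_1 + … + x_n)^{n−1}`. […] Note that oriented
spanning trees of `K⃗_n` are in bijection with rooted spanning trees of the complete undirected graph
`K_n`, by forgetting orientation.
**2.3 Complete bipartite graph.** Taking `G` to have two vertices, `a` and `b`, with `m` edges directed
from `a` to `b` and `n` edges directed from `b` to `a`, we obtain from Theorem 1.1
`κ^{vertex}(K⃗_{m,n}) = (x_1 + … + x_m + y_1 + … + y_n) × (x_1 + … + x_m)^{n−1} (y_1 + … + y_n)^{m−1}`,
where `K⃗_{m,n} = LG` is the bidirected complete bipartite graph on `m + n` vertices. The variables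
`x_1, …, x_m` correspond to vertices in the first part, and `y_1, …, y_n` correspond to vertices in the
second part.»

## What is here

* §1 `map_arcWeight`, `map_outWeight`, `map_arborescencePolyTo`, `map_arborescencePoly` — the weighted
  counts are functorial in the ring of weights; hence (§2) the identities proved with the universal
  weights `x_e ∈ ℤ[x]` hold for all weights in every commutative ring:
  **`arborescencePoly_lineDigraph_commRing`** — Theorem 1.1,
  `κ^{vertex}(G*, w*) = κ^{edge}(G, w) ∏_v s_v^{indeg v − 1}`, for `G` without sources and sinks and
  ANY `w : A → S`, `S` a commutative ring (no integral-domain or `s_v ≠ 0` hypothesis); and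
  **`arborescencePolyTo_lineDigraph_commRing`** — Theorem 2.3 likewise.
* §3 `bouquet α` — one vertex with the loops `α` (definition with body); its arc digraph is the
  complete digraph `K⃗_α` with loops; `arborescencePoly_bouquet` (`κ^{edge}(B_α, w) = 1`);
  **`arborescencePoly_lineDigraph_bouquet`** — §2.2, `κ^{vertex}(K⃗_n, x) = (x_1 + ⋯ + x_n)^{n−1}` for
  every commutative ring of weights; **`arborescencePolyTo_lineDigraph_bouquet`** — its rooted form
  `κ^{vertex}(K⃗_n, i, x) = x_i (x_1 + ⋯ + x_n)^{n−2}` (`n ≥ 2`, Theorem 2.3); and Cayley's count of the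
  spanning trees of `K_n` with a given root, **`card_arborescencesTo_lineDigraph_bouquet`**:
  `t⁻(K⃗_n, i) = n^{n−2}`.
* §4 `twoVertexDigraph α β` — two vertices `a = true`, `b = false`, the arcs `α` from `a` to `b` and
  `β` from `b` to `a` (definition with body; the digraph of `LineDigraphLaplacianSpectrum`'s unweighted
  example); **`arborescencePoly_lineDigraph_twoVertexDigraph`** — §2.3,
  `κ^{vertex}(K⃗_{m,n}) = (Σ x + Σ y)(Σ x)^{n−1}(Σ y)^{m−1}`.

No named fact, no instance, no notation.

## References

* [Levine2011] L. Levine, *Sandpile groups and spanning trees of directed line graphs*, J. Combin.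
  Theory Ser. A 118 (2011) 350–364, §2.2 and §2.3 (with Theorems 1.1 and 2.3).
* Tree: `Digraph/LineDigraphWeightedArborescences` (`arborescencePoly_lineDigraph_X`),
  `Digraph/LineDigraphRootedArborescences` (`arborescencePolyTo_lineDigraph_X`),
  `Digraph/LineDigraphLaplacianSpectrum` §4 (the unweighted `κ(K⃗_n) = n^{n−1}`,
  `κ(K⃗_{m,n}) = (m+n) m^{n−1} n^{m−1}`).
-/

namespace Literature.Combinatorics.Digraph

namespace Multidigraph

open Finset Matrix
open Literature.Combinatorics.SimpleGraph.WeightedMatrixForest Literature.Combinatorics.Enumerative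

variable {V A : Type*} (G : Multidigraph V A) {S : Type*} [CommRing S]

/-! ### §1 The weighted counts are functorial in the ring of weights -/

section Functorial

variable [Fintype V] [DecidableEq V] [Fintype A]
variable {T F : Type*} [CommRing T] [FunLike F S T] [RingHomClass F S T] (f : F)

omit [Fintype V] in
/-- `f (W_w(u, v)) = W_{f ∘ w}(u, v)`. [cite: Levine2011, §1 («polynomials in the same set of variables
`{x_e}`»: specialising the indeterminates)] -/
theorem map_arcWeight (w : A → S) (u v : V) :
    f (G.arcWeight w u v) = G.arcWeight (fun a => f (w a)) u v := by
  rw [arcWeight, arcWeight, map_sum]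

omit [Fintype V] in
/-- `f (s_w(v)) = s_{f ∘ w}(v)`. [cite: Levine2011, §1] -/
theorem map_outWeight (w : A → S) (v : V) :
    f (G.outWeight w v) = G.outWeight (fun a => f (w a)) v := by
  rw [outWeight, outWeight, map_sum]

/-- `f (κ_s(G, w)) = κ_s(G, f ∘ w)`: a ring homomorphism applied to the weights.
[cite: Levine2011, §1 («Setting all `x_e = 1` yields …»: specialising the indeterminates)] -/
theorem map_arborescencePolyTo (w : A → S) (s : V) :
    f (G.arborescencePolyTo w s) = G.arborescencePolyTo (fun a => f (w a)) s := by
  rw [arborescencePolyTo, arborescencePolyTo, map_sum]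
  exact Finset.sum_congr rfl fun T _ => map_prod f _ _

/-- `f (κ^{edge}(G, w)) = κ^{edge}(G, f ∘ w)`. [cite: Levine2011, §1] -/
theorem map_arborescencePoly (w : A → S) :
    f (G.arborescencePoly w) = G.arborescencePoly fun a => f (w a) := by
  rw [arborescencePoly, arborescencePoly, map_sum]
  exact Finset.sum_congr rfl fun s _ => G.map_arborescencePolyTo f w s

end Functorial

/-! ### §2 Theorems 1.1 and 2.3 over every commutative ring of weights -/

section AllRings

variable [Fintype V] [DecidableEq V] [Fintype A] [DecidableEq A]

/-- **Theorem 1.1 for all weights in every commutative ring**: for a finite directed multigraph without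
sources and sinks and any `w : A → S`,
`κ^{vertex}(G*, w*) = κ^{edge}(G, w) · ∏_v s_v^{indeg(v) − 1}` — the identity in the indeterminates
`x_e` (`arborescencePoly_lineDigraph_X`) specialised along `ℤ[x] → S`, `x_e ↦ w_e`.
[cite: Levine2011, Thm. 1.1] -/
theorem arborescencePoly_lineDigraph_commRing (w : A → S) (hin : ∀ v, 0 < G.inDeg v)
    (hout : ∀ v, 0 < G.outDeg v) :
    G.lineDigraph.arborescencePoly (fun p => w p.1.2) =
      G.arborescencePoly w * ∏ v, G.outWeight w v ^ (G.inDeg v - 1) := by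
  have h := congrArg (MvPolynomial.aeval w : MvPolynomial A ℤ →ₐ[ℤ] S)
    (G.arborescencePoly_lineDigraph_X hin hout)
  rw [map_mul, map_prod, map_arborescencePoly, map_arborescencePoly] at h
  simp_rw [map_pow, map_sum, MvPolynomial.aeval_X] at h
  exact h

/-- **Theorem 2.3 for all weights in every commutative ring**: for a finite directed multigraph without
sinks, with `indeg(v) ≥ 1` for all `v` and `indeg(v_*) ≥ 2`, and the root arc `a₀ : w_* → v_*`,
`κ^{vertex}(LG, e_*, w) = w_{e_*} κ^{edge}(G, w_*, w) s_{v_*}^{indeg(v_*) − 2} ∏_{v ≠ v_*} s_v^{indeg(v) − 1}`.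
[cite: Levine2011, §2, Thm. 2.3] -/
theorem arborescencePolyTo_lineDigraph_commRing (w : A → S) (a₀ : A) (hin : ∀ v, 0 < G.inDeg v)
    (h₂ : 2 ≤ G.inDeg (G.tgt a₀)) (hout : ∀ v, 0 < G.outDeg v) :
    G.lineDigraph.arborescencePolyTo (fun p => w p.1.2) a₀ =
      w a₀ * G.arborescencePolyTo w (G.src a₀) *
        (G.outWeight w (G.tgt a₀) ^ (G.inDeg (G.tgt a₀) - 2) *
          ∏ v ∈ univ.erase (G.tgt a₀), G.outWeight w v ^ (G.inDeg v - 1)) := by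
  have h := congrArg (MvPolynomial.aeval w : MvPolynomial A ℤ →ₐ[ℤ] S)
    (G.arborescencePolyTo_lineDigraph_X a₀ hin h₂ hout)
  rw [map_mul, map_mul, map_mul, map_prod, map_arborescencePolyTo, map_arborescencePolyTo,
    MvPolynomial.aeval_X] at h
  simp_rw [map_pow, map_sum, MvPolynomial.aeval_X] at h
  exact h

end AllRings

/-! ### §3 The complete digraph `K⃗_n = L(B_n)`: `κ^{vertex}(K⃗_n) = (x_1 + ⋯ + x_n)^{n−1}` -/

section Bouquet

/-- **The bouquet `B_α`**: one vertex and one loop for each `a : α` («the graph with one vertex and `n`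
loops»); its arc digraph `B_α*` is the complete digraph `K⃗_α` with a loop at each vertex.
[cite: Levine2011, §2.2] -/
def bouquet (α : Type*) : Multidigraph Unit α := ⟨fun _ => (), fun _ => ()⟩

variable {α : Type*}

/-- [cite: Levine2011, §2.2] -/
@[simp] theorem bouquet_src (a : α) : (bouquet α).src a = () := rfl

/-- [cite: Levine2011, §2.2] -/
@[simp] theorem bouquet_tgt (a : α) : (bouquet α).tgt a = () := rfl

variable [Fintype α]

/-- Every loop leaves the vertex. [cite: Levine2011, §2.2] -/
theorem outArcs_bouquet (v : Unit) : (bouquet α).outArcs v = univ :=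
  Finset.eq_univ_of_forall fun _ => mem_outArcs.2 (Subsingleton.elim _ _)

/-- Every loop enters the vertex. [cite: Levine2011, §2.2] -/
theorem inArcs_bouquet (v : Unit) : (bouquet α).inArcs v = univ :=
  Finset.eq_univ_of_forall fun _ => mem_inArcs.2 (Subsingleton.elim _ _)

/-- `outdeg = n`. [cite: Levine2011, §2.2] -/
theorem outDeg_bouquet (v : Unit) : (bouquet α).outDeg v = Fintype.card α := by
  rw [outDeg, outArcs_bouquet, Finset.card_univ]

/-- `indeg = n`. [cite: Levine2011, §2.2] -/
theorem inDeg_bouquet (v : Unit) : (bouquet α).inDeg v = Fintype.card α := by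
  rw [inDeg, inArcs_bouquet, Finset.card_univ]

/-- `s = x_1 + ⋯ + x_n`. [cite: Levine2011, §2.2] -/
theorem outWeight_bouquet (w : α → S) (v : Unit) : (bouquet α).outWeight w v = ∑ a, w a := by
  rw [outWeight, outArcs_bouquet]

/-- The one-vertex digraph has exactly the empty arborescence: `κ_v(B_α, w) = 1`.
[cite: Levine2011, §2.2 (Theorem 1.1 with `κ^{edge}(G) = 1`)] -/
theorem arborescencePolyTo_bouquet (w : α → S) (v : Unit) : (bouquet α).arborescencePolyTo w v = 1 := by
  haveI : IsEmpty {u : Unit // u ≠ v} := ⟨fun u => u.2 (Subsingleton.elim _ _)⟩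
  rw [arborescencePolyTo_eq_det, Matrix.det_isEmpty]

/-- `κ^{edge}(B_α, w) = 1`. [cite: Levine2011, §2.2] -/
theorem arborescencePoly_bouquet (w : α → S) : (bouquet α).arborescencePoly w = 1 := by
  rw [arborescencePoly, Fintype.sum_subsingleton _ (), arborescencePolyTo_bouquet]

/-- The number of arborescences of the one-vertex digraph converging to its vertex is `1`.
[cite: Levine2011, §2.2] -/
theorem card_arborescencesTo_bouquet (v : Unit) : ((bouquet α).arborescencesTo v).card = 1 := by
  have h := arborescencePolyTo_bouquet (α := α) (fun _ => (1 : ℤ)) v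
  rw [arborescencePolyTo_one] at h
  exact_mod_cast h

variable [DecidableEq α]

/-- **§2.2, the classical formula `κ^{vertex}(K⃗_n) = (x_1 + … + x_n)^{n−1}`** for the complete digraph
`K⃗_n = L(B_n)` (a loop at each vertex; the weight of an arc is the variable of its head), here for
arbitrary weights `x : α → S` in a commutative ring, `n = |α| ≥ 1`. [cite: Levine2011, §2.2] -/
theorem arborescencePoly_lineDigraph_bouquet [Nonempty α] (x : α → S) :
    (bouquet α).lineDigraph.arborescencePoly (fun p => x p.1.2) = (∑ a, x a) ^ (Fintype.card α - 1) := by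
  rw [(bouquet α).arborescencePoly_lineDigraph_commRing x
      (fun v => by rw [inDeg_bouquet]; exact Fintype.card_pos)
      (fun v => by rw [outDeg_bouquet]; exact Fintype.card_pos),
    arborescencePoly_bouquet, one_mul, Fintype.prod_subsingleton _ (), outWeight_bouquet, inDeg_bouquet]

/-- **The rooted form: `κ^{vertex}(K⃗_n, i, x) = x_i (x_1 + … + x_n)^{n−2}`** (`n ≥ 2`) — the generating
function, by head weights, of the spanning trees of `K⃗_n` converging to the vertex `i` (Theorem 2.3
for `G = B_n`, `e_* = i`, `κ^{edge}(B_n, w_*) = 1`). [cite: Levine2011, §2.2 with §2 Thm. 2.3] -/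
theorem arborescencePolyTo_lineDigraph_bouquet (h2 : 2 ≤ Fintype.card α) (x : α → S) (i : α) :
    (bouquet α).lineDigraph.arborescencePolyTo (fun p => x p.1.2) i =
      x i * (∑ a, x a) ^ (Fintype.card α - 2) := by
  haveI : Nonempty α := Fintype.card_pos_iff.1 (by omega)
  rw [(bouquet α).arborescencePolyTo_lineDigraph_commRing x i
      (fun v => by rw [inDeg_bouquet]; exact Fintype.card_pos)
      (by rw [inDeg_bouquet]; exact h2)
      (fun v => by rw [outDeg_bouquet]; exact Fintype.card_pos),
    arborescencePolyTo_bouquet, mul_one, outWeight_bouquet, inDeg_bouquet,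
    Finset.eq_empty_of_forall_notMem (s := (univ : Finset Unit).erase ((bouquet α).tgt i))
      fun v hv => Finset.ne_of_mem_erase hv (Subsingleton.elim _ _),
    Finset.prod_empty, mul_one]

/-- **Cayley: the complete digraph `K⃗_n` has `n^{n−2}` spanning trees converging to a given vertex**
(«oriented spanning trees of `K⃗_n` are in bijection with rooted spanning trees of the complete
undirected graph `K_n`»: all `x_e = 1` in the rooted form; `n ≥ 1`). [cite: Levine2011, §2.2] -/
theorem card_arborescencesTo_lineDigraph_bouquet [Nonempty α] (i : α) :
    ((bouquet α).lineDigraph.arborescencesTo i).card = Fintype.card α ^ (Fintype.card α - 2) := by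
  by_cases h2 : 2 ≤ Fintype.card α
  · have h := arborescencePolyTo_lineDigraph_bouquet h2 (fun _ => (1 : ℤ)) i
    rw [arborescencePolyTo_one, one_mul, Finset.sum_const, Finset.card_univ, nsmul_eq_mul, mul_one] at h
    exact_mod_cast h
  · -- `n = 1`: the single vertex `i` with its loop; the empty arborescence
    have h1 : Fintype.card α = 1 := le_antisymm (by omega) Fintype.card_pos
    haveI : Subsingleton α := Fintype.card_le_one_iff_subsingleton.1 h1.le
    haveI : IsEmpty {a : α // a ≠ i} := ⟨fun a => a.2 (Subsingleton.elim _ _)⟩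
    have h := (bouquet α).lineDigraph.card_arborescencesTo_eq_det_laplacian (R := ℤ) i
    rw [Matrix.det_isEmpty] at h
    rw [h1, one_pow]
    exact_mod_cast h

end Bouquet

/-! ### §4 The complete bipartite digraph `K⃗_{m,n} = L(G)`, `G = (a ⇄ b)` -/

section TwoVertex

/-- **The two-vertex digraph** with the arcs `α` from `a = true` to `b = false` and the arcs `β` from
`b` to `a` («`G` has two vertices, `a` and `b`, with `m` edges directed from `a` to `b` and `n` edges
directed from `b` to `a`»); its arc digraph is the bidirected complete bipartite digraph `K⃗_{α,β}`.
[cite: Levine2011, §2.3] -/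
def twoVertexDigraph (α β : Type*) : Multidigraph Bool (α ⊕ β) := ⟨Sum.isLeft, Sum.isRight⟩

variable {α β : Type*}

/-- [cite: Levine2011, §2.3] -/
@[simp] theorem twoVertexDigraph_src (e : α ⊕ β) : (twoVertexDigraph α β).src e = e.isLeft := rfl

/-- [cite: Levine2011, §2.3] -/
@[simp] theorem twoVertexDigraph_tgt (e : α ⊕ β) : (twoVertexDigraph α β).tgt e = e.isRight := rfl

variable [Fintype α] [Fintype β]

/-- The arcs leaving `a`: the `α`. [cite: Levine2011, §2.3] -/
theorem outArcs_twoVertexDigraph_true : (twoVertexDigraph α β).outArcs true = univ.map Function.Embedding.inl := by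
  ext e
  rcases e with e | e <;> simp [mem_outArcs]

/-- The arcs leaving `b`: the `β`. [cite: Levine2011, §2.3] -/
theorem outArcs_twoVertexDigraph_false :
    (twoVertexDigraph α β).outArcs false = univ.map Function.Embedding.inr := by
  ext e
  rcases e with e | e <;> simp [mem_outArcs]

/-- The arcs entering `a`: the `β`. [cite: Levine2011, §2.3] -/
theorem inArcs_twoVertexDigraph_true : (twoVertexDigraph α β).inArcs true = univ.map Function.Embedding.inr := by
  ext e
  rcases e with e | e <;> simp [mem_inArcs]

/-- The arcs entering `b`: the `α`. [cite: Levine2011, §2.3] -/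
theorem inArcs_twoVertexDigraph_false :
    (twoVertexDigraph α β).inArcs false = univ.map Function.Embedding.inl := by
  ext e
  rcases e with e | e <;> simp [mem_inArcs]

/-- `outdeg(a) = m`. [cite: Levine2011, §2.3] -/
theorem outDeg_twoVertexDigraph_true : (twoVertexDigraph α β).outDeg true = Fintype.card α := by
  rw [outDeg, outArcs_twoVertexDigraph_true, Finset.card_map, Finset.card_univ]

/-- `outdeg(b) = n`. [cite: Levine2011, §2.3] -/
theorem outDeg_twoVertexDigraph_false : (twoVertexDigraph α β).outDeg false = Fintype.card β := by
  rw [outDeg, outArcs_twoVertexDigraph_false, Finset.card_map, Finset.card_univ]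

/-- `indeg(a) = n`. [cite: Levine2011, §2.3] -/
theorem inDeg_twoVertexDigraph_true : (twoVertexDigraph α β).inDeg true = Fintype.card β := by
  rw [inDeg, inArcs_twoVertexDigraph_true, Finset.card_map, Finset.card_univ]

/-- `indeg(b) = m`. [cite: Levine2011, §2.3] -/
theorem inDeg_twoVertexDigraph_false : (twoVertexDigraph α β).inDeg false = Fintype.card α := by
  rw [inDeg, inArcs_twoVertexDigraph_false, Finset.card_map, Finset.card_univ]

/-- `s_a = x_1 + ⋯ + x_m`. [cite: Levine2011, §2.3] -/
theorem outWeight_twoVertexDigraph_true (x : α → S) (y : β → S) :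
    (twoVertexDigraph α β).outWeight (Sum.elim x y) true = ∑ a, x a := by
  rw [outWeight, outArcs_twoVertexDigraph_true, Finset.sum_map]
  rfl

/-- `s_b = y_1 + ⋯ + y_n`. [cite: Levine2011, §2.3] -/
theorem outWeight_twoVertexDigraph_false (x : α → S) (y : β → S) :
    (twoVertexDigraph α β).outWeight (Sum.elim x y) false = ∑ b, y b := by
  rw [outWeight, outArcs_twoVertexDigraph_false, Finset.sum_map]
  rfl

/-- No loops: `W(u, u) = 0`. [cite: Levine2011, §2.3] -/
theorem arcWeight_twoVertexDigraph_self (w : α ⊕ β → S) (u : Bool) :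
    (twoVertexDigraph α β).arcWeight w u u = 0 := by
  have hset : (twoVertexDigraph α β).arcsFromTo u u = ∅ := by
    rw [Finset.eq_empty_iff_forall_notMem]
    intro e he
    rw [mem_arcsFromTo, twoVertexDigraph_src, twoVertexDigraph_tgt] at he
    cases u <;> rcases e with e | e <;> simp at he
  rw [arcWeight, hset, Finset.sum_empty]

/-- The arborescences converging to a vertex of the two-vertex digraph are the single arcs entering it:
`κ_u(G, w) = s_{¬u}`, the out-weight of the other vertex. [cite: Levine2011, §2.3 (Theorem 1.1 with
`κ^{edge}(G) = Σ x + Σ y`)] -/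
theorem arborescencePolyTo_twoVertexDigraph (w : α ⊕ β → S) (u : Bool) :
    (twoVertexDigraph α β).arborescencePolyTo w u = (twoVertexDigraph α β).outWeight w (!u) := by
  have hu : (!u) ≠ u := by cases u <;> decide
  haveI : Unique {v : Bool // v ≠ u} :=
    { default := ⟨!u, hu⟩
      uniq := fun v => Subtype.ext (by
        rcases v with ⟨v, hv⟩
        cases u <;> cases v <;> simp_all) }
  rw [arborescencePolyTo_eq_det, Matrix.det_unique,
    show (default : {v : Bool // v ≠ u}) = ⟨!u, hu⟩ from Subsingleton.elim _ _, submatrix_apply,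
    wLaplacian_arcWeight_apply_self, arcWeight_twoVertexDigraph_self, sub_zero]

/-- `κ^{edge}(G, (x, y)) = (x_1 + ⋯ + x_m) + (y_1 + ⋯ + y_n)`. [cite: Levine2011, §2.3] -/
theorem arborescencePoly_twoVertexDigraph (x : α → S) (y : β → S) :
    (twoVertexDigraph α β).arborescencePoly (Sum.elim x y) = (∑ a, x a) + ∑ b, y b := by
  rw [arborescencePoly, Fintype.sum_bool, arborescencePolyTo_twoVertexDigraph,
    arborescencePolyTo_twoVertexDigraph, Bool.not_true, Bool.not_false,
    outWeight_twoVertexDigraph_false, outWeight_twoVertexDigraph_true, add_comm]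

variable [DecidableEq α] [DecidableEq β]

/-- **§2.3: `κ^{vertex}(K⃗_{m,n}) = (x_1 + … + x_m + y_1 + … + y_n) × (x_1 + … + x_m)^{n−1} (y_1 + … + y_n)^{m−1}`**
for the bidirected complete bipartite digraph `K⃗_{m,n} = LG` (the weight of an arc of `LG` is the
variable of its head: `x` on the part `α`, `y` on the part `β`), for arbitrary weights in a commutative
ring, `m = |α| ≥ 1`, `n = |β| ≥ 1`. [cite: Levine2011, §2.3] -/
theorem arborescencePoly_lineDigraph_twoVertexDigraph [Nonempty α] [Nonempty β] (x : α → S) (y : β → S) :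
    (twoVertexDigraph α β).lineDigraph.arborescencePoly (fun p => Sum.elim x y p.1.2) =
      ((∑ a, x a) + ∑ b, y b) * (∑ a, x a) ^ (Fintype.card β - 1) * (∑ b, y b) ^ (Fintype.card α - 1) := by
  rw [(twoVertexDigraph α β).arborescencePoly_lineDigraph_commRing (Sum.elim x y)
      (fun v => by
        cases v
        · rw [inDeg_twoVertexDigraph_false]; exact Fintype.card_pos
        · rw [inDeg_twoVertexDigraph_true]; exact Fintype.card_pos)
      (fun v => by
        cases v
        · rw [outDeg_twoVertexDigraph_false]; exact Fintype.card_pos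
        · rw [outDeg_twoVertexDigraph_true]; exact Fintype.card_pos),
    arborescencePoly_twoVertexDigraph, Fintype.prod_bool, outWeight_twoVertexDigraph_true,
    outWeight_twoVertexDigraph_false, inDeg_twoVertexDigraph_true, inDeg_twoVertexDigraph_false, mul_assoc]

/-- All `x = y = 1`: **`κ(K⃗_{m,n}) = (m + n) m^{n−1} n^{m−1}`** (the unweighted example of
`LineDigraphLaplacianSpectrum`, now for the named digraph). [cite: Levine2011, §1 and §2.3] -/
theorem sum_card_arborescencesTo_lineDigraph_twoVertexDigraph [Nonempty α] [Nonempty β] :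
    ∑ e, ((twoVertexDigraph α β).lineDigraph.arborescencesTo e).card =
      (Fintype.card α + Fintype.card β) * Fintype.card α ^ (Fintype.card β - 1) *
        Fintype.card β ^ (Fintype.card α - 1) := by
  have h := arborescencePoly_lineDigraph_twoVertexDigraph (α := α) (β := β)
    (fun _ => (1 : ℤ)) (fun _ => (1 : ℤ))
  have hw : (fun p : {p : (α ⊕ β) × (α ⊕ β) // (twoVertexDigraph α β).tgt p.1 =
      (twoVertexDigraph α β).src p.2} => Sum.elim (fun _ => (1 : ℤ)) (fun _ => (1 : ℤ)) p.1.2) =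
      fun _ => 1 := by
    funext p
    rcases p with ⟨⟨e₁, e₂ | e₂⟩, hp⟩ <;> rfl
  rw [hw, arborescencePoly_one] at h
  simp only [Finset.sum_const, Finset.card_univ, nsmul_eq_mul, mul_one] at h
  exact_mod_cast h

end TwoVertex

end Multidigraph

end Literature.Combinatorics.Digraph
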